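import Literature.AnabelianGeometry.EtaleTheta.Discharge.Sec1CyclotomicPackageGaloisLocus
import Literature.AnabelianGeometry.EtaleTheta.SettingModelKrullTate2
import Literature.AnabelianGeometry.EtaleTheta.SettingModelLevelKernels
import Literature.AnabelianGeometry.EtaleTheta.SettingModelCyclotomicCharacterLevelNontrivial
import Literature.AnabelianGeometry.EtaleTheta.CyclotomeZHatEquiv
import Literature.AnabelianGeometry.SemiGraphs.TemperedCurveGalois
import HarnessLib

/-!
# The [EtTh] §1 p. 12 cyclotomic package FAILS at the untwisted KRULL model `modelκ′`: `Π^tp_X` acts TRIVIALLY on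
# `Δ^ell_X` of its bridge datum while `G_{ℚ_p}` MOVES roots of unity — the negative twin of
# `SettingModelChiCyclotomicPackage` (proof-only)

S. Mochizuki, *The étale theta function and its Frobenioid-theoretic manifestations*, Publ. RIMS **45** (2009)
[EtTh], §1, PRIMS PDF p. 12 (printed p. 238): «`1 → Ẑ(1) → Δ^ell_X → Ẑ → 1` … Thus, `(Δ^tp_Y)^ell ≅ Ẑ(1)`»
[cite: MochizukiEtTh2009, §1 p.12]; p. 13 (the cyclotomic character) [cite: MochizukiEtTh2009, §1 p.13].

Cell abc-iut, layer L2 (NV lane), seat abc-iut-L2-t7 (gen 4).  PROOF-ONLY (0 definitions).  CENSUS TWIN of this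
seat's `SettingModelChiCyclotomicPackage` (χ-bridge: the package HOLDS): at the L3 bridge datum
`D₀ := (ThetaSetting.modelκ′ p).toOncePuncturedTemperedGroup e` of abc-iut-L2-t10's untwisted Krull model (`Π^tp_X =
Γ ⋊_{θ∘1} G_{ℚ_p}`, the carrier where `CuspLaws`, `OncePuncturedData` and `IsThm16Origin` are ALL inhabited —
`SettingModelKrullCuspLaws`, abc-iut-w5-d165's `SettingModelKrullCuspThm16Origin`), for EVERY bundle `e`:

* `exists_levels_bridgeκ'` — the Heisenberg `x`/`y`-coordinates of abc-iut-L2-t1/w5-d024's `ĥ_N` descend to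
  `Δ^ell_X` (as in the χ-file); `levelXY_conj_bridgeκ'` — BOTH are INVARIANT under `Π^tp_X` (the arithmetic factor
  acts on `Γ` through `θ_1 = id`, abc-iut-w5-d024's `twist_one`); `eq_one_of_levels_eq_one_bridgeκ'`;
* **`conjDeltaEll_eq_self_bridgeκ'`** — hence `Π^tp_X` acts TRIVIALLY on `Δ^ell_X` of the Krull bridge datum;
* **`not_isTateTwist_closureDeltaY_bridgeκ'`** — so, by abc-iut-f-172's kernel locus for Galois-trivial data
  (`not_isTateTwist_of_gal_moves_rootOfUnity`, p443083) and the NON-TRIVIALITY of the cyclotomic character of `ℚ_p`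
  (abc-iut-w5-d091's `exists_levelChar_sq_chi_ne_one`, transported to `K̄₀` along abc-iut-L3-t12's
  `galoisIdentification`, `exists_galApply_ne_bridgeκ'`), the F-1697 carrier (closure of `Δ^tp_Y` in `Δ^ell_X`) is
  NOT a Tate twist: **`not_deltaYEllClosureIsoTate_body_bridgeκ'`** — the F-1697 body is FALSE at the Krull bridge,
  and `exists_inhabited_origin_not_deltaYEllClosureIsoTate_krull` packages it as an inhabited origin violating F-1697.

CENSUS SUMMARY (with `SettingModelChiCyclotomicPackage` / `SettingModelCuspLawsCensus` / `SettingModelKrullCuspLaws`):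
χ-bridge — p.12 package ✓, `CuspLaws` ✗ (C3); Krull bridge — `CuspLaws` ✓ (+ `IsThm16Origin` ✓), p.12 package ✗.  No model
in the tree carries both (cf. abc-iut-w5-d165's power-twist obstruction).  HONEST LABEL: semi-synthetic models,
consistency bookkeeping for OUR typed predicates; nothing of [EtTh] asserted; no side taken on [IUTchIII] Cor. 3.12;
typed ≠ proved.
-/

noncomputable section

namespace Literature.AnabelianGeometry.EtaleTheta.SettingModel

open Literature.AnabelianGeometry.SemiGraphs _root_.Topology
open OncePuncturedTemperedGroup (galApply)

variable (p : ℕ) [Fact p.Prime]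

/-! ## §1. The bridge datum of `modelκ′` -/

/-- `Δ̂` of the Krull bridge datum is `Ker(Π_X → G_{ℚ_p}) = F̂₂ ⋊ 1`. [cite: MochizukiEtTh2009, §1 p.12] -/
theorem bridgeκ'_deltaHat (e : (ThetaSetting.modelκ' p).OncePuncturedData) :
    ((ThetaSetting.modelκ' p).toOncePuncturedTemperedGroup e).deltaHat =
      (SemidirectProduct.rightHom : PiHtκ p →* GQp p).ker := by
  rw [ThetaSetting.toOncePuncturedTemperedGroup_deltaHat]
  exact deltaHatκ_eq p

/-- Membership in `Δ̂` of the Krull bridge datum: `right = 1`. [cite: MochizukiEtTh2009, §1 p.12] -/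
theorem mem_bridgeκ'_deltaHat_iff (e : (ThetaSetting.modelκ' p).OncePuncturedData) (n : PiHtκ p) :
    n ∈ ((ThetaSetting.modelκ' p).toOncePuncturedTemperedGroup e).deltaHat ↔ n.right = 1 := by
  rw [bridgeκ'_deltaHat]
  exact Iff.rfl

/-- `[Δ̂, Δ̂]⁻` of the Krull bridge datum is `inl([F̂₂, F̂₂])⁻`: membership = `left ∈ [F̂₂,F̂₂]⁻ ∧ right = 1`.
[cite: MochizukiEtTh2009, §1 p.12] -/
theorem mem_ellKerHat_bridgeκ'_iff (e : (ThetaSetting.modelκ' p).OncePuncturedData) (n : PiHtκ p) :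
    n ∈ ((ThetaSetting.modelκ' p).toOncePuncturedTemperedGroup e).ellKerHat ↔
      n.left ∈ (⁅(⊤ : Subgroup F₂hatT), (⊤ : Subgroup F₂hatT)⁆).topologicalClosure ∧ n.right = 1 := by
  unfold OncePuncturedTemperedGroup.ellKerHat
  rw [ThetaSetting.toOncePuncturedTemperedGroup_deltaHat]
  change n ∈ (⁅(curveκ p).DeltaHat, (curveκ p).DeltaHat⁆).topologicalClosure ↔ _
  rw [deltaHat_curveκ_eq_map_inl, ← Subgroup.map_commutator, mem_topologicalClosure_map_inl_PiHtκ_iff]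

/-- On `Δ̂ = F̂₂ ⋊ 1` of the Krull model the `left` component is multiplicative. [cite: MochizukiEtTh2009, §1 p.12] -/
theorem left_mul_of_right_eq_one_hatκ {g : PiHtκ p} (hg : g.right = 1) (h : PiHtκ p) :
    (g * h).left = g.left * h.left := by
  rw [SemidirectProduct.mul_left, hg, map_one, MulAut.one_apply]

/-- Conjugation inside `Π_X = F̂₂ ⋊_{θ∘1} G_{ℚ_p}` of an element of `Δ̂`: the `left` component is `γ · w · γ⁻¹`
(the arithmetic factor acts through `θ_1 = id`, abc-iut-w5-d024's `twist_one`). [cite: MochizukiEtTh2009, §1 p.12] -/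
theorem left_conj_of_right_eq_one_hatκ (g n : PiHtκ p) (hn : n.right = 1) :
    (g * n * g⁻¹).left = g.left * n.left * g.left⁻¹ := by
  simp only [SemidirectProduct.mul_left, SemidirectProduct.mul_right, SemidirectProduct.inv_left, hn, mul_one,
    map_inv, MulAut.apply_inv_self, actHatκ_apply, MonoidHom.one_apply, twist_one]

/-! ## §2. The level coordinates on `Δ^ell_X` of the Krull bridge, and their INVARIANCE -/

/-- The Heisenberg `x`/`y`-coordinates descend to continuous homomorphisms `X_N, Y_N : Δ^ell_X → ℤ/N` on the Krull
bridge datum (same construction as at the χ-bridge). [cite: MochizukiEtTh2009, §1 p.12] -/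
theorem exists_levels_bridgeκ' (e : (ThetaSetting.modelκ' p).OncePuncturedData) :
    ∃ X Y : ∀ N : ℕ+, ((ThetaSetting.modelκ' p).toOncePuncturedTemperedGroup e).DeltaEll →* Multiplicative (ZMod N),
      (∀ N, Continuous (X N)) ∧ (∀ N, Continuous (Y N)) ∧
      (∀ (N : ℕ+) (n : PiHtκ p) (hn : n ∈ ((ThetaSetting.modelκ' p).toOncePuncturedTemperedGroup e).deltaHat),
        X N (QuotientGroup.mk ⟨n, hn⟩) = Multiplicative.ofAdd (hHat N n.left).x) ∧
      (∀ (N : ℕ+) (n : PiHtκ p) (hn : n ∈ ((ThetaSetting.modelκ' p).toOncePuncturedTemperedGroup e).deltaHat),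
        Y N (QuotientGroup.mk ⟨n, hn⟩) = Multiplicative.ofAdd (hHat N n.left).y) := by
  let v : ↥((ThetaSetting.modelκ' p).toOncePuncturedTemperedGroup e).deltaHat → PiHtκ p := fun n => n.1
  have hv_mul : ∀ a b, v (a * b) = v a * v b := fun _ _ => rfl
  have hv_one : v 1 = 1 := rfl
  have hright : ∀ n, (v n).right = 1 := fun n => (mem_bridgeκ'_deltaHat_iff p e _).mp n.2
  let X₀ : ∀ N : ℕ+, ↥((ThetaSetting.modelκ' p).toOncePuncturedTemperedGroup e).deltaHat →* Multiplicative (ZMod N) :=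
    fun N =>
      { toFun := fun n => Multiplicative.ofAdd (hHat N (v n).left).x
        map_one' := by rw [hv_one, SemidirectProduct.one_left, map_one, Heis.one_x, ofAdd_zero]
        map_mul' := fun a b => by
          rw [hv_mul, left_mul_of_right_eq_one_hatκ p (hright a) _, map_mul, Heis.mul_x, ofAdd_add] }
  let Y₀ : ∀ N : ℕ+, ↥((ThetaSetting.modelκ' p).toOncePuncturedTemperedGroup e).deltaHat →* Multiplicative (ZMod N) :=
    fun N =>
      { toFun := fun n => Multiplicative.ofAdd (hHat N (v n).left).y
        map_one' := by rw [hv_one, SemidirectProduct.one_left, map_one, Heis.one_y, ofAdd_zero]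
        map_mul' := fun a b => by
          rw [hv_mul, left_mul_of_right_eq_one_hatκ p (hright a) _, map_mul, Heis.mul_y, ofAdd_add] }
  have hX₀ : ∀ N n, X₀ N n = Multiplicative.ofAdd (hHat N (v n).left).x := fun _ _ => rfl
  have hY₀ : ∀ N n, Y₀ N n = Multiplicative.ofAdd (hHat N (v n).left).y := fun _ _ => rfl
  have hvc : Continuous v := continuous_subtype_val
  have hleft : Continuous fun n => (v n).left := (continuous_fst.comp (continuous_leftRightHatκ p)).comp hvc
  have hX₀c : ∀ N, Continuous (X₀ N) := fun N =>
    continuous_ofAdd.comp ((continuous_of_discreteTopology (f := fun h : Heis (ZMod N) => h.x)).comp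
      ((hHat N).continuous.comp hleft))
  have hY₀c : ∀ N, Continuous (Y₀ N) := fun N =>
    continuous_ofAdd.comp ((continuous_of_discreteTopology (f := fun h : Heis (ZMod N) => h.y)).comp
      ((hHat N).continuous.comp hleft))
  have hker : ∀ N, (((ThetaSetting.modelκ' p).toOncePuncturedTemperedGroup e).ellKerHat.subgroupOf
      ((ThetaSetting.modelκ' p).toOncePuncturedTemperedGroup e).deltaHat) ≤ (X₀ N).ker ⊓ (Y₀ N).ker := by
    intro N n hn
    rw [Subgroup.mem_subgroupOf] at hn
    change v n ∈ ((ThetaSetting.modelκ' p).toOncePuncturedTemperedGroup e).ellKerHat at hn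
    rw [mem_ellKerHat_bridgeκ'_iff, mem_closure_commutator₂_iff_forall_hHat] at hn
    rw [Subgroup.mem_inf, MonoidHom.mem_ker, MonoidHom.mem_ker, hX₀, hY₀, (hn.1 N).1, (hn.1 N).2, ofAdd_zero]
    exact ⟨rfl, rfl⟩
  refine ⟨fun N => QuotientGroup.lift _ (X₀ N) ((hker N).trans inf_le_left),
    fun N => QuotientGroup.lift _ (Y₀ N) ((hker N).trans inf_le_right), ?_, ?_, ?_, ?_⟩
  · intro N
    rw [← QuotientGroup.isOpenQuotientMap_mk.continuous_comp_iff]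
    exact hX₀c N
  · intro N
    rw [← QuotientGroup.isOpenQuotientMap_mk.continuous_comp_iff]
    exact hY₀c N
  · intro N n hn
    rfl
  · intro N n hn
    rfl

/-- Every element of `Δ^ell_X` of the Krull bridge is the class of some `n` with `n.right = 1`.
[cite: MochizukiEtTh2009, §1 p.12] -/
theorem exists_mk_eq_bridgeκ' (e : (ThetaSetting.modelκ' p).OncePuncturedData)
    (x : ((ThetaSetting.modelκ' p).toOncePuncturedTemperedGroup e).DeltaEll) :
    ∃ (n : PiHtκ p) (hn : n ∈ ((ThetaSetting.modelκ' p).toOncePuncturedTemperedGroup e).deltaHat),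
      n.right = 1 ∧ x = QuotientGroup.mk ⟨n, hn⟩ := by
  obtain ⟨m, rfl⟩ := QuotientGroup.mk_surjective x
  exact ⟨m.1, m.2, (mem_bridgeκ'_deltaHat_iff p e _).mp m.2, rfl⟩

/-- **Both level coordinates are INVARIANT under `Π^tp_X`** at the Krull bridge: conjugation by `(γ, σ)` acts on
the `left` component of `Δ̂` by `Inn(γ)` only (`θ_1 = id`), invisible on the abelian coordinates `x`, `y`.
[cite: MochizukiEtTh2009, §1 p.12] -/
theorem levelXY_conj_bridgeκ' (e : (ThetaSetting.modelκ' p).OncePuncturedData)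
    (X Y : ∀ N : ℕ+, ((ThetaSetting.modelκ' p).toOncePuncturedTemperedGroup e).DeltaEll →* Multiplicative (ZMod N))
    (hX : ∀ (N : ℕ+) (n : PiHtκ p) (hn : n ∈ ((ThetaSetting.modelκ' p).toOncePuncturedTemperedGroup e).deltaHat),
      X N (QuotientGroup.mk ⟨n, hn⟩) = Multiplicative.ofAdd (hHat N n.left).x)
    (hY : ∀ (N : ℕ+) (n : PiHtκ p) (hn : n ∈ ((ThetaSetting.modelκ' p).toOncePuncturedTemperedGroup e).deltaHat),
      Y N (QuotientGroup.mk ⟨n, hn⟩) = Multiplicative.ofAdd (hHat N n.left).y)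
    (N : ℕ+) (g : PiTpκ p) (x : ((ThetaSetting.modelκ' p).toOncePuncturedTemperedGroup e).DeltaEll) :
    X N (((ThetaSetting.modelκ' p).toOncePuncturedTemperedGroup e).conjDeltaEll g x) = X N x ∧
      Y N (((ThetaSetting.modelκ' p).toOncePuncturedTemperedGroup e).conjDeltaEll g x) = Y N x := by
  obtain ⟨n, hn, hn1, rfl⟩ := exists_mk_eq_bridgeκ' p e x
  have hmem : toHatκ p g * n * (toHatκ p g)⁻¹ ∈ ((ThetaSetting.modelκ' p).toOncePuncturedTemperedGroup e).deltaHat := by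
    rw [mem_bridgeκ'_deltaHat_iff, SemidirectProduct.mul_right, SemidirectProduct.mul_right, hn1, mul_one,
      SemidirectProduct.inv_right, mul_inv_cancel]
  have hconj : ((ThetaSetting.modelκ' p).toOncePuncturedTemperedGroup e).conjDeltaHat g ⟨n, hn⟩ =
      ⟨toHatκ p g * n * (toHatκ p g)⁻¹, hmem⟩ :=
    Subtype.ext (((ThetaSetting.modelκ' p).toOncePuncturedTemperedGroup e).coe_conjDeltaHat g _)
  have hmap : ((ThetaSetting.modelκ' p).toOncePuncturedTemperedGroup e).conjDeltaEll g (QuotientGroup.mk ⟨n, hn⟩) =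
      QuotientGroup.mk (((ThetaSetting.modelκ' p).toOncePuncturedTemperedGroup e).conjDeltaHat g ⟨n, hn⟩) := rfl
  refine ⟨?_, ?_⟩
  · rw [hmap, hconj, hX, hX, left_conj_of_right_eq_one_hatκ p _ _ hn1, map_mul, map_mul, Heis.mul_x, Heis.mul_x,
      map_inv, Heis.inv_x]
    congr 1
    ring
  · rw [hmap, hconj, hY, hY, left_conj_of_right_eq_one_hatκ p _ _ hn1, map_mul, map_mul, Heis.mul_y, Heis.mul_y,
      map_inv, Heis.inv_y]
    congr 1
    ring

/-- **Joint injectivity of the levels on `Δ^ell_X`** of the Krull bridge (as in the χ-file).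
[cite: MochizukiEtTh2009, §1 p.12] -/
theorem eq_one_of_levels_eq_one_bridgeκ' (e : (ThetaSetting.modelκ' p).OncePuncturedData)
    (X Y : ∀ N : ℕ+, ((ThetaSetting.modelκ' p).toOncePuncturedTemperedGroup e).DeltaEll →* Multiplicative (ZMod N))
    (hX : ∀ (N : ℕ+) (n : PiHtκ p) (hn : n ∈ ((ThetaSetting.modelκ' p).toOncePuncturedTemperedGroup e).deltaHat),
      X N (QuotientGroup.mk ⟨n, hn⟩) = Multiplicative.ofAdd (hHat N n.left).x)
    (hY : ∀ (N : ℕ+) (n : PiHtκ p) (hn : n ∈ ((ThetaSetting.modelκ' p).toOncePuncturedTemperedGroup e).deltaHat),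
      Y N (QuotientGroup.mk ⟨n, hn⟩) = Multiplicative.ofAdd (hHat N n.left).y)
    (x : ((ThetaSetting.modelκ' p).toOncePuncturedTemperedGroup e).DeltaEll) (h : ∀ N : ℕ+, X N x = 1 ∧ Y N x = 1) :
    x = 1 := by
  obtain ⟨n, hn, hn1, rfl⟩ := exists_mk_eq_bridgeκ' p e x
  rw [QuotientGroup.eq_one_iff, Subgroup.mem_subgroupOf]
  change n ∈ ((ThetaSetting.modelκ' p).toOncePuncturedTemperedGroup e).ellKerHat
  rw [mem_ellKerHat_bridgeκ'_iff, mem_closure_commutator₂_iff_forall_hHat]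
  refine ⟨fun N => ?_, hn1⟩
  have hNx := (h N).1
  have hNy := (h N).2
  rw [hX, ofAdd_eq_one] at hNx
  rw [hY, ofAdd_eq_one] at hNy
  exact ⟨hNx, hNy⟩

/-- **`Π^tp_X` acts TRIVIALLY on `Δ^ell_X` of the Krull bridge datum** (both levels of `(g·x)·x⁻¹` vanish).
[cite: MochizukiEtTh2009, §1 p.12] -/
theorem conjDeltaEll_eq_self_bridgeκ' (e : (ThetaSetting.modelκ' p).OncePuncturedData) (g : PiTpκ p)
    (x : ((ThetaSetting.modelκ' p).toOncePuncturedTemperedGroup e).DeltaEll) :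
    ((ThetaSetting.modelκ' p).toOncePuncturedTemperedGroup e).conjDeltaEll g x = x := by
  obtain ⟨X, Y, -, -, hX, hY⟩ := exists_levels_bridgeκ' p e
  rw [← mul_inv_eq_one]
  refine eq_one_of_levels_eq_one_bridgeκ' p e X Y hX hY _ fun N => ?_
  obtain ⟨hx, hy⟩ := levelXY_conj_bridgeκ' p e X Y hX hY N g x
  rw [map_mul, map_inv, hx, mul_inv_cancel, map_mul, map_inv, hy, mul_inv_cancel]
  exact ⟨rfl, rfl⟩

/-! ## §3. `G_{ℚ_p}` moves roots of unity of `K̄₀`; the package fails -/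

/-- **The absolute Galois group of `K₀ = ℚ_p` (the bottom subfield of `ℚ̄_p`) MOVES a root of unity of `K̄₀`**: the
cyclotomic character of `G_{ℚ_p}` is non-trivial at level `p²` (abc-iut-w5-d091's `exists_levelChar_sq_chi_ne_one`),
so some `σ` moves a primitive `p²`-th root of unity of `ℚ̄_p` — transported to `K̄₀ = AlgebraicClosure K₀` along
abc-iut-L3-t12's `galoisIdentification` (`ι σ = E ∘ σ ∘ E⁻¹`). [cite: MochizukiEtTh2009, §1 p.13] -/
theorem exists_galApply_ne_bridgeκ' :
    ∃ (σ : Field.absoluteGaloisGroup ↥(curveκ' p).K) (n : ℕ) (_ : 0 < n) (ζ : AlgebraicClosure ↥(curveκ' p).K),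
      ζ ^ n = 1 ∧ galApply σ ζ ≠ ζ := by
  haveI : CharZero (PadicAlgCl p) := charZero_padicAlgCl p
  set N : ℕ+ := ⟨p ^ 2, pow_pos (Fact.out : p.Prime).pos 2⟩ with hN
  obtain ⟨σ₀, hσ₀⟩ := exists_levelChar_sq_chi_ne_one p
  -- a primitive `p²`-th root of unity of `ℚ̄_p`, moved by `σ₀`
  obtain ⟨μ, hμ⟩ := cyclotome.exists_isPrimitiveRoot_of_isSepClosed (PadicAlgCl p) (N : ℕ) N.pos
  have hmove : σ₀ μ ≠ μ := fun h => hσ₀ (levelChar_chi_eq_one_of_apply_eq p σ₀ N hμ h)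
  -- `σ₀ ∈ G_{K₀} = ⊤`
  have hGK : (curveκ' p).GK = ⊤ := by
    change (⊥ : IntermediateField ℚ_[p] (PadicAlgCl p)).fixingSubgroup = ⊤
    exact IntermediateField.fixingSubgroup_bot
  have hσmem : σ₀ ∈ (curveκ' p).GK := by rw [hGK]; exact Subgroup.mem_top _
  set E := Literature.FieldTheory.Galois.algEquivAlgebraicClosure (curveκ' p).K with hE
  refine ⟨(curveκ' p).galoisIdentification ⟨σ₀, hσmem⟩, N, N.pos, E μ, ?_, ?_⟩
  · rw [← map_pow, hμ.pow_eq_one, map_one]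
  · -- `(ι σ₀) (E μ) = E (σ₀ μ) ≠ E μ`
    have h := (curveκ' p).galoisIdentification_symm_apply ((curveκ' p).galoisIdentification ⟨σ₀, hσmem⟩) μ
    rw [ContinuousMulEquiv.symm_apply_apply] at h
    -- h : σ₀ μ = E.symm ((ι σ₀) (E μ))
    intro heq
    apply hmove
    change (σ₀ : GQp p) μ = E.symm (galApply ((curveκ' p).galoisIdentification ⟨σ₀, hσmem⟩) (E μ)) at h
    rw [h, heq, AlgEquiv.symm_apply_apply]

/-- **The F-1697 carrier is NOT a Tate twist at the Krull bridge** (for EVERY bundle `e` and every `Π^tp_X`-stable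
closed `T ≤ Δ^ell_X` with carrier the closure of `Δ^tp_Y`): abc-iut-f-172's `not_isTateTwist_of_gal_moves_rootOfUnity`
fed with `conjDeltaEll_eq_self_bridgeκ'` and `exists_galApply_ne_bridgeκ'`. [cite: MochizukiEtTh2009, §1 p.12] -/
theorem not_isTateTwist_closureDeltaY_bridgeκ' (e : (ThetaSetting.modelκ' p).OncePuncturedData)
    (T : Subgroup ((ThetaSetting.modelκ' p).toOncePuncturedTemperedGroup e).DeltaEll)
    (hT : ∀ g, ∀ t ∈ T, ((ThetaSetting.modelκ' p).toOncePuncturedTemperedGroup e).conjDeltaEll g t ∈ T)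
    (hTc : IsClosed (T : Set ((ThetaSetting.modelκ' p).toOncePuncturedTemperedGroup e).DeltaEll))
    (hTset : (T : Set ((ThetaSetting.modelκ' p).toOncePuncturedTemperedGroup e).DeltaEll) =
      closure ((fun δ : ((ThetaSetting.modelκ' p).toOncePuncturedTemperedGroup e).delta =>
        (QuotientGroup.mk ⟨((ThetaSetting.modelκ' p).toOncePuncturedTemperedGroup e).toHat δ,
          Subgroup.le_topologicalClosure _ ⟨δ, δ.2, rfl⟩⟩ :
            ((ThetaSetting.modelκ' p).toOncePuncturedTemperedGroup e).DeltaEll)) ''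
          {δ | (δ : ((ThetaSetting.modelκ' p).toOncePuncturedTemperedGroup e).Pi) ∈
            ((ThetaSetting.modelκ' p).toOncePuncturedTemperedGroup e).piY})) :
    ¬ ((ThetaSetting.modelκ' p).toOncePuncturedTemperedGroup e).IsTateTwist T
        ((ThetaSetting.modelκ' p).toOncePuncturedTemperedGroup e).conjDeltaEll hT := by
  haveI : CharZero ↥(curveκ' p).K := SubsemiringClass.instCharZero (curveκ' p).K
  obtain ⟨σ, n, hn, ζ, hζ, hmove⟩ := exists_galApply_ne_bridgeκ' p
  exact OncePuncturedCyclotomic.not_isTateTwist_of_gal_moves_rootOfUnity _ (conjDeltaEll_eq_self_bridgeκ' p e) hn hζ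
    hmove T hT hTc hTset

/-- **The F-1697 body «`(Δ^tp_Y)^ell ≅ Ẑ(1)`» is FALSE at the Krull bridge datum**, for every bundle `e`.
[cite: MochizukiEtTh2009, §1 p.12] -/
theorem not_deltaYEllClosureIsoTate_body_bridgeκ' (e : (ThetaSetting.modelκ' p).OncePuncturedData) :
    ¬ ∃ (T : Subgroup ((ThetaSetting.modelκ' p).toOncePuncturedTemperedGroup e).DeltaEll)
        (hT : ∀ g, ∀ t ∈ T, ((ThetaSetting.modelκ' p).toOncePuncturedTemperedGroup e).conjDeltaEll g t ∈ T),
      IsClosed (T : Set ((ThetaSetting.modelκ' p).toOncePuncturedTemperedGroup e).DeltaEll) ∧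
      ((ThetaSetting.modelκ' p).toOncePuncturedTemperedGroup e).IsTateTwist T
        ((ThetaSetting.modelκ' p).toOncePuncturedTemperedGroup e).conjDeltaEll hT ∧
      (T : Set ((ThetaSetting.modelκ' p).toOncePuncturedTemperedGroup e).DeltaEll) =
        closure ((fun δ : ((ThetaSetting.modelκ' p).toOncePuncturedTemperedGroup e).delta =>
          (QuotientGroup.mk ⟨((ThetaSetting.modelκ' p).toOncePuncturedTemperedGroup e).toHat δ,
            Subgroup.le_topologicalClosure _ ⟨δ, δ.2, rfl⟩⟩ :
              ((ThetaSetting.modelκ' p).toOncePuncturedTemperedGroup e).DeltaEll)) ''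
            {δ | (δ : ((ThetaSetting.modelκ' p).toOncePuncturedTemperedGroup e).Pi) ∈
              ((ThetaSetting.modelκ' p).toOncePuncturedTemperedGroup e).piY}) := by
  rintro ⟨T, hT, hTc, hTw, hTset⟩
  exact not_isTateTwist_closureDeltaY_bridgeκ' p e T hT hTc hTset hTw

/-- **Census packaging (negative twin of `exists_inhabited_origin_cyclotomicPackage_chi`)**: over `K₀ = ℚ_p` there is an
INHABITED origin hypothesis — «is the Krull bridge datum» — VIOLATING the typed F-1697 `DeltaYEllClosureIsoTate`
(hence, by abc-iut-f-172's reductions, not carrying the p. 12 package), although its datum satisfies `CuspLaws`,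
carries `OncePuncturedData` and (abc-iut-w5-d165) `IsThm16Origin`. [cite: MochizukiEtTh2009, §1 p.12] -/
theorem exists_inhabited_origin_not_deltaYEllClosureIsoTate_krull (e : (ThetaSetting.modelκ' p).OncePuncturedData) :
    ∃ Ω : TemperedPiOrigin ↥(curveκ' p).K,
      (∃ D, Ω.IsTateOrigin D) ∧ ¬ OncePuncturedTemperedGroup.DeltaYEllClosureIsoTate Ω := by
  refine ⟨{ IsOfGeometricOrigin := fun _ => True
            IsTateOrigin := fun D => D = (ThetaSetting.modelκ' p).toOncePuncturedTemperedGroup e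
            isOfGeometricOrigin_of_isTateOrigin := fun _ _ => trivial },
    ⟨_, rfl⟩, fun h => ?_⟩
  exact not_deltaYEllClosureIsoTate_body_bridgeκ' p e (h _ rfl)

end Literature.AnabelianGeometry.EtaleTheta.SettingModel

end
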